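import Summits.PneNP.PneNP.Theses.RootDecompQuantumCell

/-!
# `RootDecompQuantumCell.ForrelationRung` (stmt-PneNP-29735) — the decided rung beneath the quantum cell

Node N19 of the decomp-pnenp root-decomposition cell (route `route-PneNP-RootDecompQuantumCell`)
records, as an aside, the restricted-model theorem beneath `BQP^A ⊄ PH^A`: Raz–Tal, Thm 7.4 — the
Forrelation distribution fools bounded-depth circuits.  The item is VERBATIM the tree's named fact
`Literature.Computability.QuantumComplexity.RazTal2022_thm74`, which the tree proves from Tal's
`AC⁰` Fourier-tail bound: `razTal2022_thm74_of_tal Tal2017_fourierL1_ac0_holds` (modules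
`RazTalBoundedDepth`, `QueryComplexityProofs`, both in the import cone of the route file through
`OracleSeparationsProofs`).  One-line port owed to the prover lane (TREE debt D12 (h)).  0 sorry.
-/

namespace Summit.PneNP.PneNP.Theorems

/-- The decided rung `ForrelationRung` (stmt-PneNP-29735): Raz–Tal 2022 Thm 7.4, obtained in the
tree from Tal 2017 (`Tal2017_fourierL1_ac0_holds`) by `razTal2022_thm74_of_tal`, read through the
route declaration (decomp-pnenp cell, 2026-08-30). -/
theorem forrelationRung_proof :
    Summit.PneNP.PneNP.Theses.RootDecompQuantumCell.ForrelationRung := by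
  unfold Summit.PneNP.PneNP.Theses.RootDecompQuantumCell.ForrelationRung
  exact Literature.Computability.QuantumComplexity.razTal2022_thm74_of_tal
    Literature.Computability.QuantumComplexity.Tal2017_fourierL1_ac0_holds

end Summit.PneNP.PneNP.Theorems
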